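import Mathlib
import Summits.Langlands.Langlands.Theses.PicardMuOrdinary
import Literature.NumberTheory.GaloisRepresentations.CubicResidueSymbol
import Literature.NumberTheory.GaloisRepresentations.OrdinaryRegular
import Literature.NumberTheory.GaloisRepresentations.AbsGaloisOuterConj
import Literature.NumberTheory.Automorphic.Eigenvariety
import Literature.NumberTheory.Automorphic.ReciprocityGLnProofs
import Literature.NumberTheory.Automorphic.OrdinaryPolarizedAutomorphicLimit
import Literature.AlgebraicGeometry.Motives.PicardCurveMuOrdinaryReduction
import Literature.FieldTheory.AlgClosed.PadicAlgClEquivComplex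

/-!
# Line `definite-trianguline-fern` — checked skeleton for the crux
`Summit.Langlands.Langlands.Theses.PicardMuOrdinary.MuOrdinaryFamilyRT` (stmt-Langlands-13757)

Planner crux-plan, round 1 (idea card `Cruxes/MuOrdinaryFamilyRT/Ideas/definite-trianguline-fern.md`,
triage `TRIAGE-r1-1.md`; line card `Lines/definite-trianguline-fern.md`).

Seven registered stubs `stub_*` (each `theorem stub_X : <signature> := by sorry`, a genuine lemma of
the line stated over existing declarations plus the abbreviations of the Vocabulary section) and the
kernel-checked composition `MuOrdinaryFamilyRT_of : MuOrdinaryFamilyRT` — the term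
`stub_picardRep → stub_muOrdinaryShape → stub_polarizedSeed → stub_arcAccumulation → stub_definiteFern →
stub_limitDictionary → stub_supersingularRemainder → MuOrdinaryFamilyRT` spelled out as a proof that
invokes exactly these seven theorems (sorries live only inside the seven stubs; pattern of
`Cruxes/TwistUnpackaging/Lines/kummer-chebotarev-separating-twists.lean`).

THE LINE (idea A: "pro-automorphy is inner-form blind").  For a generic Picard curve `C : y³ = f(x)`
over `ℚ` with μ-ordinary (3-rank-2, λ-distinguished) potentially good reduction at `3`
(`HasMuOrdinaryReductionAtThree f`, definition D1 of the route, landed — THE SCOPE of the line, i.e.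
the route's foreseen child `RTMuOrdinary`), and with `K = ℚ(ω)`, the 3-adic representation `ρ_C : Γ_K → GL₃(ℚ̄₃)` (weights `{0,0,1}`/`{0,1,1}`, IRREGULAR)
is placed as a point `x_C` of tame level `S` on the 3-adic eigenvariety of the DEFINITE unitary group
`U(3)_{K/ℚ}` at the prime `3` RAMIFIED in `K` (patched-eigenvariety comparison of
Breuil–Hellmann–Schraen type; the irregular weight becomes a non-dominant point of weight space, the
ramified prime a local question on the trianguline/ordinary component through
`x_loc = (ρ_C|_{Γ_{K_λ}}, δ_C)`); equidimensionality of the eigenvariety (dimension `3 = dim 𝒲`) plus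
the ARC ACCUMULATION LEMMA (finite torsion-free algebras over `ℤ₃⟦t⟧`: points over `t = 0` are limits
of points over `t = s_k → 0`) gives classical points `y_k → x_C` of very regular weights with Hecke
eigenvalues converging UNIFORMLY away from `S`; Rogawski base change `U(3) → GL₃/K` makes them regular
algebraic cuspidal `P_k`, and the `ℤ̄_𝔐`-dictionary turns `‖t(y_k) − t(x_C)‖ ≤ 3^{-k}` into the typed
congruences of the crux.

Shape (data flow of `MuOrdinaryFamilyRT_of`):
* `stub_picardRep` — the 3-adic realisation `ρ` of `C_f` over `K`: unramified outside a finite `S₀ ∋ λ`,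
  geometric-Frobenius traces `ι(tr ρ(Frob_v)) = e(a_v(f))` (`picardTrace`), Frobenius characteristic
  polynomials reducing to the branch-point table, semisimple, polarised in trace form (Weil pairing +
  `ℤ[ω]`).  [known mathematics; étale H¹ + Lefschetz; L]
* `stub_muOrdinaryShape` — K3 of the card: `HasMuOrdinaryReductionAtThree f ⇒ ρ|_{Γ_{K_λ}}` is
  Borel-valued, ordinary of some (NON-dominant) labelled weight (connected–étale filtration of the
  Néron model; triage: "H_ab automatic"). [M–L]
* `stub_polarizedSeed` — polarised regular-weight residual automorphy: a regular algebraic cuspidal,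
  conjugate-self-dual-up-to-twist `P₀` on `GL₃/K` of some finite level with attached `r₀ ≡ ρ (mod 𝔪)`
  (odd: `BC_K(Sym² g)⊗χ` from Langlands–Tunnell/Deligne–Serre; even: JPSS cubic induction from the CM
  sextic).  The crux's typed residual hypothesis is NOT consumed (triage cross-cutting note 2: its `P`
  is neither polarised nor λ-ordinary); this stub re-derives the polarised seed. [L]
* `stub_arcAccumulation` — the accumulation lemma, pure commutative algebra over `ℤ₃⟦t⟧` (provable now). [M–L]
* `stub_definiteFern` — THE LEVER (hardest; K1 + K2 of the card): granted the accumulation lemma, for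
  `f` in scope the datum of an eigenvariety of tame level `S₁` for `GL₃/K` (populated from the definite
  `U(3)` by Rogawski base change) whose classical points are cuspidal with algebraic-integer Hecke
  eigenvalues, containing a point `x` with `T_{v,1}`-eigenvalues `tr ρ(Frob_v)` at which classical
  points accumulate uniformly away from `S₁`. [open; BHS-type accessibility at a ramified prime]
* `stub_limitDictionary` — the card's First lemma + the `ℤ̄_𝔐` dictionary: such a datum and the trace
  identity give the typed conclusion (`∃ e 𝔐 S ∀ k ∃ P_k …`). [M; provable from the interface]
* `stub_supersingularRemainder` — the HONEST REMAINDER, not attacked by this line: generic `f` with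
  `¬ HasMuOrdinaryReductionAtThree f` (λ-supersingular, repeated unit root, or not potentially good:
  refuter objection O1, "no engine").  It is EXACTLY the route's foreseen child `RTSupersingular`
  (two-layer plan (1), to be filed under D1); the lead should hand it back (`promote-stub`) rather than
  prove it, and it drops out of the skeleton when the tenure planner splits the crux.

Disproof.lean: none exists for this crux on this hub (payload `disproof_path` absent; `ledger crux ls`
shows no `Disproof.lean`, 2026-08-16) — no `_false_without_` obstruction to honour yet.  Honoured
instead from the refuter's crux-attack (EVIDENCE.md §7): `S ∋ λ` and all bad primes (the `S` of the
conclusion is `S₀ ∪ S₁ ∪ {v ∣ 3}`), no `k`-dependent auxiliary primes (tame level `S₁` fixed in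
`OnDefiniteEigenvariety`), normalisation `N𝔭·Σα = ι(t_{v,1})`.
-/

set_option linter.dupNamespace false
set_option linter.unusedVariables false

noncomputable section

open scoped NumberField Polynomial
open IsDedekindDomain Filter Topology
open Literature.NumberTheory.GaloisRepresentations Literature.NumberTheory.Automorphic
open Literature.AlgebraicGeometry.Motives

namespace Summit.Langlands.Langlands.Cruxes.MuOrdinaryFamilyRT.DefiniteTriangulineFern

/-! ## Vocabulary (abbreviations of sub-clauses; everything unfolds to existing declarations) -/

/-- `K = ℚ(ω)`. -/
abbrev Kω : Type := CyclotomicField 3 ℚ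

/-- Finite places of `K`. -/
abbrev Pl : Type := HeightOneSpectrum (𝓞 Kω)

/-- The genericity hypotheses of the crux on `f`: a separable quartic with `12 ∣ #Gal(f)`
(`Gal(f) ∈ {A₄, S₄}`). -/
def Generic (f : ℤ[X]) : Prop :=
  f.natDegree = 4 ∧ (f.map (Int.castRingHom ℚ)).Separable ∧ 12 ∣ Nat.card (f.map (Int.castRingHom ℚ)).Gal

open scoped Classical in
/-- The branch-point characteristic polynomial of `Frob_𝔭` on `J(C_f)[1-ω] ≅ 𝔽₃[roots f]/diag`
(the five-case table of the crux, verbatim; classical decidability as in the route file). -/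
def branchPointPoly (f : ℤ[X]) (𝔭 : Pl) : ℤ[X] :=
  if (f.map ((Ideal.Quotient.mk 𝔭.asIdeal).comp (algebraMap ℤ (𝓞 Kω)))).roots.toFinset.card = 4
    then (Polynomial.X - 1) ^ 3
  else if (f.map ((Ideal.Quotient.mk 𝔭.asIdeal).comp (algebraMap ℤ (𝓞 Kω)))).roots.toFinset.card = 2
    then (Polynomial.X - 1) ^ 2 * (Polynomial.X + 1)
  else if (f.map ((Ideal.Quotient.mk 𝔭.asIdeal).comp (algebraMap ℤ (𝓞 Kω)))).roots.toFinset.card = 1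
    then Polynomial.X ^ 3 - 1
  else if (∃ y : (𝓞 Kω) ⧸ 𝔭.asIdeal,
      y ^ 2 = (f.map ((Ideal.Quotient.mk 𝔭.asIdeal).comp (algebraMap ℤ (𝓞 Kω)))).discr)
    then (Polynomial.X - 1) * (Polynomial.X + 1) ^ 2
  else Polynomial.X ^ 3 + Polynomial.X ^ 2 + Polynomial.X + 1

/-- The crux's typed residual-automorphy hypothesis, verbatim (kept only to state the remainder stub
and to name the unused hypothesis of `MuOrdinaryFamilyRT_of`). -/
def ResAut (f : ℤ[X]) (hcpt : isCompact_glFiniteIntegralLevel 3 Kω) : Prop :=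
  ∃ (P : CuspidalAutomorphicRepData 3 Kω hcpt) (𝔐 : Ideal (integralClosure ℤ ℂ)),
    P.1.IsRegularAlgebraic ∧ 𝔐.IsMaximal ∧ (3 : (integralClosure ℤ ℂ)) ∈ 𝔐 ∧
    ∀ᶠ 𝔭 : Pl in Filter.cofinite, ∃ (α : Multiset ℂ) (Q : Polynomial (integralClosure ℤ ℂ)),
      P.1.HasSatakeParamAt 𝔭 α ∧
      Q.map (algebraMap (integralClosure ℤ ℂ) ℂ) =
        (α.map (fun a => Polynomial.X - Polynomial.C ((𝔭.residueCard : ℂ) * a))).prod ∧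
      Q.map (Ideal.Quotient.mk 𝔐) = (branchPointPoly f 𝔭).map (Int.castRingHom ((integralClosure ℤ ℂ) ⧸ 𝔐))

/-- The crux's typed conclusion, verbatim: `ρ_C` is a 3-adic limit of regular algebraic cuspidal
automorphic representations (trace congruences `mod 3^k ℤ̄_𝔐` off a fixed finite `S`). -/
def LimitConcl (f : ℤ[X]) (hcpt : isCompact_glFiniteIntegralLevel 3 Kω) : Prop :=
  ∃ (e : Kω →+* ℂ) (𝔐 : Ideal (integralClosure ℤ ℂ)) (S : Finset Pl),
    𝔐.IsMaximal ∧ (3 : (integralClosure ℤ ℂ)) ∈ 𝔐 ∧ ∀ k : ℕ,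
      ∃ P : CuspidalAutomorphicRepData 3 Kω hcpt, P.1.IsRegularAlgebraic ∧
        ∀ 𝔭 ∉ S, ∃ (α : Multiset ℂ) (t u : (integralClosure ℤ ℂ)), P.1.HasSatakeParamAt 𝔭 α ∧
          (t : ℂ) = (𝔭.residueCard : ℂ) * α.sum - e (picardTrace f 𝔭) ∧ u ∉ 𝔐 ∧
          u * t ∈ Ideal.span {(3 : (integralClosure ℤ ℂ)) ^ k}

/-- **`ρ` is a 3-adic Picard representation of `f` off `S`** (through `ι : ℚ̄₃ ≃ ℂ`, `e : K → ℂ`): at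
every `v ∉ S`, `ρ` is unramified, the GEOMETRIC Frobenius (`σ⁻¹` for an arithmetic Frobenius `σ`,
Hansen/HLTT convention of the tree) has trace `ι⁻¹(e(a_v(f)))` — `a_v(f) = picardTrace f v` is the
trace of geometric Frobenius on the `ω`-part of `H¹(C_f)` — and its characteristic polynomial is
congruent modulo `𝔪_{ℚ̄₃}` to the branch-point polynomial (`J[1-ω] ≅` reflection module). -/
def IsPicardRep (ι : PadicAlgCl 3 ≃+* ℂ) (e : Kω →+* ℂ) (f : ℤ[X]) (S : Set Pl)
    (ρ : FramedGaloisRep Kω (PadicAlgCl 3) 3) : Prop :=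
  ∀ v ∉ S, ρ.IsUnramifiedAt v ∧
    ∀ 𝔓 ∈ v.primesAbove, ∀ σ : Field.absoluteGaloisGroup Kω, IsArithFrobAt (𝓞 Kω) σ 𝔓 →
      ι (FramedRep.trace ρ σ⁻¹) = e (picardTrace f v) ∧
      ∀ i : ℕ, ‖(FramedRep.charpoly ρ σ⁻¹).coeff i -
        ι.symm (((branchPointPoly f v).map (Int.castRingHom ℂ)).coeff i)‖ < 1

/-- `K = ℚ(ω)` is Galois over `ℚ` (Mathlib `IsCyclotomicExtension.isGalois`, registered as an
instance for `absGaloisQuot` / `absGaloisOuterConj`). -/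
instance instIsCyclotomicKω : IsCyclotomicExtension {3} ℚ Kω :=
  CyclotomicField.isCyclotomicExtension 3 ℚ

/-- See `instIsCyclotomicKω`. -/
instance instIsGaloisKω : IsGalois ℚ Kω := IsCyclotomicExtension.isGalois {3} ℚ Kω

/-- **Polarised in trace form** with respect to complex conjugation: for every `c ∈ Γ_ℚ ∖ Γ_K`,
`tr ρ(θ_c σ) = χ(σ) tr ρ(σ⁻¹)` for a character `χ` (`ρ^c ≅ ρ^∨ ⊗ χ`; accepted `IsTracePolarized`,
`absGaloisOuterConj`). For `ρ_C`: Weil pairing + `ℤ[ω]`-action (Bellaïche–Chenevier sign `+1`,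
refuter audit). -/
def Polarized (ρ : FramedGaloisRep Kω (PadicAlgCl 3) 3) : Prop :=
  ∀ c : Field.absoluteGaloisGroup ℚ, absGaloisQuot ℚ Kω c ≠ 1 →
    IsTracePolarized (absGaloisOuterConj ℚ Kω c) (FramedRep.trace ρ)

/-- **Local shape at `v ∣ 3`** (B-ordinary of SOME labelled weight, not required dominant):
relative to some local Artin datum of `K_v`, `ρ|_{Γ_{K_v}}` is conjugate to an upper-triangular
representation whose diagonal characters are algebraic of weight `wt` on an open subgroup of
inertia (accepted `IsOrdinaryOfLabelledWeightAt`, Geraghty/BLGGT §1.4).  For `ρ_C` μ-ordinary the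
weight is the NON-dominant `(−1,−1,0)`-type weight (irregular Hodge–Tate weights). -/
def LocalShapeAt (v : Pl) (ρ : FramedGaloisRep Kω (PadicAlgCl 3) 3) : Prop :=
  ∃ (art : LocalArtinData (v.adicCompletion Kω))
    (wt : LabelledWeight (v.adicCompletion Kω) (PadicAlgCl 3) 3),
    ρ.IsOrdinaryOfLabelledWeightAt v art wt

/-- **Residual congruence of two 3-adic representations**: characteristic polynomials congruent
modulo `𝔪_{ℚ̄₃}` on all of `Γ_K` (full characteristic polynomials, not traces: `p = n = 3`). -/
def Congruent (r ρ : FramedGaloisRep Kω (PadicAlgCl 3) 3) : Prop :=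
  ∀ (σ : Field.absoluteGaloisGroup Kω) (i : ℕ),
    ‖(FramedRep.charpoly r σ).coeff i - (FramedRep.charpoly ρ σ).coeff i‖ < 1

/-- **A polarised regular seed congruent to `ρ`** at level `hcpt`: a regular algebraic cuspidal `P₀`
on `GL₃(𝔸_K)`, unramified outside a finite `S₁`, with an attached `r₀` (HLTT compatibility at the
unramified `v ∤ 3`, accepted `IsGaloisCompatibleAt`) that is polarised in trace form and congruent to
`ρ`. -/
def HasPolarizedSeed (ι : PadicAlgCl 3 ≃+* ℂ) (hcpt : isCompact_glFiniteIntegralLevel 3 Kω)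
    (ρ : FramedGaloisRep Kω (PadicAlgCl 3) 3) : Prop :=
  ∃ (P₀ : CuspidalAutomorphicRepData 3 Kω hcpt) (r₀ : FramedGaloisRep Kω (PadicAlgCl 3) 3)
    (S₁ : Set Pl), S₁.Finite ∧ P₀.1.IsRegularAlgebraic ∧
    (∀ v ∉ S₁, (3 : 𝓞 Kω) ∉ v.asIdeal → P₀.1.IsUnramifiedAt v ∧ IsGaloisCompatibleAt P₀.1 ι r₀ v) ∧
    Polarized r₀ ∧ Congruent r₀ ρ

/-- **`ρ` lies on a definite eigenvariety of tame level `S₁` on which classical points accumulate at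
it** — the typed output of the lever, over the accepted interface `Eigenvariety K 3 3 S₁` (datum for
`GL₃/K`, to be populated from the eigenvariety of the definite `U(3)` by Rogawski base change):
classical points are cuspidal automorphic (`ClassicalPointsCuspidal`) with ALGEBRAIC-INTEGER
`T_{v,1}`-eigenvalues (automatic on the definite group: forms are `ℤ̄`-valued functions on a finite
set), and there is a point `x` whose `T_{v,1}`-eigenvalue is the geometric-Frobenius trace of `ρ` at
every `v ∉ S₁`, such that for every `k` some classical point has all its `T_{v,1}`-eigenvalues,
`v ∉ S₁`, within `3^{-k}` of those of `x` (uniform accumulation). -/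
def OnDefiniteEigenvariety (ι : PadicAlgCl 3 ≃+* ℂ) (hcpt : isCompact_glFiniteIntegralLevel 3 Kω)
    (S₁ : Set Pl) (ρ : FramedGaloisRep Kω (PadicAlgCl 3) 3) : Prop :=
  ∃ E : Eigenvariety Kω 3 3 S₁,
    E.ClassicalPointsCuspidal hcpt ι ∧
    (∀ y ∈ E.classical, ∀ v ∉ S₁, ∃ t : integralClosure ℤ ℂ, (t : ℂ) = ι (E.heckeEigenvalue y v 1)) ∧
    ∃ x : E.Pt,
      (∀ v ∉ S₁, ∀ 𝔓 ∈ v.primesAbove, ∀ σ : Field.absoluteGaloisGroup Kω,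
        IsArithFrobAt (𝓞 Kω) σ 𝔓 → E.heckeEigenvalue x v 1 = FramedRep.trace ρ σ⁻¹) ∧
      ∀ k : ℕ, ∃ y ∈ E.classical, ∀ v ∉ S₁,
        ‖E.heckeEigenvalue y v 1 - E.heckeEigenvalue x v 1‖ ≤ ((3 : ℝ)⁻¹) ^ k

/-- The inclusion `ℤ₃ → ℚ̄₃`. -/
def zpToCl : ℤ_[3] →+* PadicAlgCl 3 :=
  (algebraMap ℚ_[3] (PadicAlgCl 3)).comp PadicInt.Coe.ringHom

/-- **`y : D → ℚ̄₃` lies over the point `t = s` of `Spf ℤ₃⟦t⟧`**: restricted along the structure map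
`ℤ₃⟦t⟧ → D` it is evaluation at `s` (`‖s‖ < 1`), i.e. `y(F) = Σ_n F_n s^n`. -/
def LiesOver {D : Type} [CommRing D] [Algebra (PowerSeries ℤ_[3]) D] (y : D →+* PadicAlgCl 3)
    (s : PadicAlgCl 3) : Prop :=
  ∀ F : PowerSeries ℤ_[3],
    HasSum (fun n : ℕ => zpToCl (PowerSeries.coeff n F) * s ^ n) (y (algebraMap (PowerSeries ℤ_[3]) D F))

/-- **THE ARC ACCUMULATION LEMMA** (pure commutative algebra; the endgame of "equidimension ⇒
accumulation" restricted to an arc of weight space).  Let `D` be a domain, module-finite and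
torsion-free over `ℤ₃⟦t⟧`, `x₀ : D → ℚ̄₃` a point over `t = 0`, and `s_k → 0` in `ℚ̄₃` with `‖s_k‖ < 1`.
Then there are points `y_k : D → ℚ̄₃` over `t = s_k` with `y_k(b) → x₀(b)` for every `b ∈ D`.
(Proof sketch, planner-verified: `D_𝔮` is free of rank `d` at the height-one primes `𝔮_s = ker ev_s`;
for `b ∈ D` the characteristic polynomial `χ_b ∈ ℤ₃⟦t⟧[X]` specialises at `s` to the characteristic
polynomial of `b` on the `d`-dimensional fibre, whose roots are the values `y(b)` at the geometric
points over `s`; `χ_b^{(s_k)} → χ_b^{(0)}` coefficientwise (`|F(s) − F(0)| ≤ |s|`), so every root of the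
limit is a limit of roots (`∏_j |r − r_{k,j}| = |χ^{(s_k)}(r)| → 0`); choose `b*` separating the
finitely many points over `0`, pick `y_k` with `y_k(b*) → x₀(b*)`, and conclude `y_k(b) → x₀(b)` for all
`b` from the same root argument applied to `b* + λ b`, `λ ∈ ℤ₃` small.) -/
def ArcAccumulation : Prop :=
  ∀ (D : Type) [CommRing D] [IsDomain D] [Algebra (PowerSeries ℤ_[3]) D]
    [Module.Finite (PowerSeries ℤ_[3]) D],
    Function.Injective (algebraMap (PowerSeries ℤ_[3]) D) →
    ∀ (x₀ : D →+* PadicAlgCl 3), LiesOver x₀ 0 →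
    ∀ (s : ℕ → PadicAlgCl 3), (∀ k, ‖s k‖ < 1) → Tendsto s atTop (𝓝 0) →
    ∃ y : ℕ → (D →+* PadicAlgCl 3), (∀ k, LiesOver (y k) (s k)) ∧
      ∀ b : D, Tendsto (fun k => y k b) atTop (𝓝 (x₀ b))

/-! ## The seven stubs (registered: `theorem stub_X : <signature> := by sorry`) -/

/-- **Stub 1 — the 3-adic Galois representation of the Picard curve** (known mathematics, L-sized in
Lean: Tate module of `J(C_f)`, `ℤ[ω]`-eigenpart, Néron–Ogg–Šafarevič off `3·disc·lead`, the Lefschetz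
count `#C(𝔽_q) = q + 1 + S_χ + S_χ̄` giving `a_v = picardTrace`, `J[1−ω] ≅ 𝔽₃[roots]/diag` for the
residual polynomials, Weil pairing + `ℤ[ω]` for the polarisation).  For generic `f` and EVERY
`ι : ℚ̄₃ ≃ ℂ` there are an embedding `e : K → ℂ`, a finite set `S₀` of places containing those above
`3`, and a semisimple `ρ : Γ_K → GL₃(ℚ̄₃)` which is a 3-adic Picard representation of `f` off `S₀`
and polarised in trace form. -/
theorem stub_picardRep :
    ∀ f : ℤ[X], Generic f → ∀ ι : PadicAlgCl 3 ≃+* ℂ,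
      ∃ (e : Kω →+* ℂ) (S₀ : Set Pl) (ρ : FramedGaloisRep Kω (PadicAlgCl 3) 3),
        S₀.Finite ∧ (∀ v : Pl, (3 : 𝓞 Kω) ∈ v.asIdeal → v ∈ S₀) ∧
        ρ.toGaloisRep.IsSemisimple ∧ IsPicardRep ι e f S₀ ρ ∧ Polarized ρ := by
  sorry

/-- **Stub 2 — local input at `λ` (card K3; triage "H_ab automatic").**  If `C_f` has μ-ordinary
λ-distinguished potentially good reduction at `3`, then every semisimple 3-adic Picard representation
`ρ` of `f` (it is `≅ ρ_C` by Chebotarev + Brauer–Nesbitt) is, at each `v ∣ 3` (i.e. `v = λ`),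
B-ordinary of some labelled weight: over the Galois closure of a good-reduction field the filtration
multiplicative ⊂ connected ⊂ all of `𝒥[3^∞]` is canonical, stable under `Γ_{K_λ}`, with `𝒪_{K_λ}`-rank-one
graded pieces, so `ρ|_{Γ_{K_λ}}` is upper triangular with diagonal characters (finite on inertia) ×
(algebraic of Hodge–Tate type `(1,1)`, `(0,1)`/`(1,0)`, `(0,0)`) — ordinary of the non-dominant weight
`(−1,−1,0)`-type (`IsOrdinaryOfLabelledWeightAt`, no dominance asked). -/
theorem stub_muOrdinaryShape :
    ∀ f : ℤ[X], Generic f → HasMuOrdinaryReductionAtThree f →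
      ∀ (ι : PadicAlgCl 3 ≃+* ℂ) (e : Kω →+* ℂ) (S₀ : Set Pl) (ρ : FramedGaloisRep Kω (PadicAlgCl 3) 3),
        S₀.Finite → IsPicardRep ι e f S₀ ρ → ρ.toGaloisRep.IsSemisimple →
        ∀ v : Pl, (3 : 𝓞 Kω) ∈ v.asIdeal → LocalShapeAt v ρ := by
  sorry

/-- **Stub 3 — polarised regular-weight residual automorphy (the free seed of `S₄ ≅ PGL₂(𝔽₃)`).**
For generic `f`, every 3-adic Picard representation `ρ` of `f` admits, at every level datum `hcpt`, a
polarised regular seed congruent to it (`HasPolarizedSeed`): fewer than four real roots — the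
projective `S₄/A₄` representation is odd, Langlands–Tunnell + Deligne–Serre give `g`, and
`P₀ = BC_{K/ℚ}(Sym² g) ⊗ χ` (Gelbart–Jacquet, Arthur–Clozel; `Ad⁰σ̄ ≅ reflection ⊗ sgn`, `χ` the
quadratic/Teichmüller adjustment; `ω|_{Γ_K} = 1` so Tate twists are invisible mod `3`); four real
roots — `P₀ = AI` from the CM sextic `K₃(ω)` of a type-`(0,1,2|2,1,0)` Hecke character (JPSS).  `r₀`
by HLTT (`exists_galoisRep_of_regularAlgebraic`); polarisation because `P₀^c ≅ P₀^∨ ⊗ μ`.  This is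
the route's support items ResidualAutomorphyOdd/Even PLUS polarisation; the crux's typed residual
hypothesis is not usable here (its `P` need not be polarised). -/
theorem stub_polarizedSeed :
    ∀ f : ℤ[X], Generic f →
      ∀ (ι : PadicAlgCl 3 ≃+* ℂ) (e : Kω →+* ℂ) (S₀ : Set Pl) (ρ : FramedGaloisRep Kω (PadicAlgCl 3) 3),
        S₀.Finite → IsPicardRep ι e f S₀ ρ → ρ.toGaloisRep.IsSemisimple →
        ∀ hcpt : isCompact_glFiniteIntegralLevel 3 Kω, HasPolarizedSeed ι hcpt ρ := by
  sorry

/-- **Stub 4 — the arc accumulation lemma** (`ArcAccumulation`, stated above; commutative algebra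
over `ℤ₃⟦t⟧`, provable from Mathlib: freeness over the DVR localisations of `ℤ₃⟦t⟧`, characteristic
polynomials of module-finite extensions and their specialisations, roots in the algebraically closed
`ℚ̄₃`, the elementary root-continuity estimate).  It is the endgame shared by every line on this crux
(triage cross-cutting note 1): "finite over weight space / equidimensional ⇒ classical weights
accumulate at the irregular point". -/
theorem stub_arcAccumulation :
    ∀ (D : Type) [CommRing D] [IsDomain D] [Algebra (PowerSeries ℤ_[3]) D]
    [Module.Finite (PowerSeries ℤ_[3]) D],
    Function.Injective (algebraMap (PowerSeries ℤ_[3]) D) →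
    ∀ (x₀ : D →+* PadicAlgCl 3), LiesOver x₀ 0 →
    ∀ (s : ℕ → PadicAlgCl 3), (∀ k, ‖s k‖ < 1) → Tendsto s atTop (𝓝 0) →
    ∃ y : ℕ → (D →+* PadicAlgCl 3), (∀ k, LiesOver (y k) (s k)) ∧
      ∀ b : D, Tendsto (fun k => y k b) atTop (𝓝 (x₀ b)) := by
  sorry

/-- **Stub 5 — THE LEVER (hardest; K1 + K2 of the card): `ρ` is a point of the definite eigenvariety
and classical points accumulate at it.**  Granted the arc accumulation lemma: for generic `f` IN SCOPE
(μ-ordinary λ-distinguished potentially good reduction at `3`), a semisimple polarised 3-adic Picard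
representation `ρ` of `f`, B-ordinary of some labelled weight at `λ`, with a polarised regular seed
congruent to it, lies `OnDefiniteEigenvariety` for some finite tame level `S₁`.  Intended proof (idea A):
(i) eigenvariety `𝓔` of the definite `U(3)_{K/ℚ}` of tame level `N(f)·N(seed)`, Iwahori level at the
ramified `3`, weight space `𝒲` of dimension `3` (Loeffler 2011 / Chenevier 2004 / Emerton 2006;
Bellaïche: equidimensional of dimension `dim 𝒲`); Galois determinants (Chenevier, `p = 3` allowed);
classical points ↦ cuspidal regular algebraic `Π` on `GL₃/K` by Rogawski base change, Hecke
eigenvalues algebraic integers; (ii) patched eigenvariety `X_p(ρ̄) ⊂ (Spf R^p_∞)^rig × X^{pol}_tri(ρ̄_λ)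
× 𝕌^g` (Breuil–Hellmann–Schraen 2017/2019 transplanted to `G(ℚ₃)` = ramified `U(3)`, `L = ℚ₃(√−3)`,
Taylor–Wiles primes for `S₄` over `W(𝔽₉)`, the `ζ₃`/`p = n` deficit handled as in Thorne's 2-adic
template — triage sharpenings 2–3); the seed makes `S_∞ ≠ 0`; `x_loc = (ρ|_{Γ_{K_λ}}, δ)` is a
φ-generic (purity + distinct slopes `0, ½, 1`) point of the ORDINARY (Borel) component `Z_loc`, which
carries the ordinary specialisations of the seed's Hida family, hence is accessible:
`x = (ρ, δ) ∈ X_p(ρ̄) ×_{𝔛_∞} {𝔞 = 0} = 𝓔(ρ̄)`; (iii) an affinoid neighbourhood of `x` is finite and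
torsion-free (componentwise) over a polydisc of `𝒲`; restrict to the arc `t ↦ κ_x · κ_{(2,1,0)}^t`
through the very regular dominant weights `t_k = 2·3^k → 0`, complete at `(3,t)`, apply
`ArcAccumulation` to the component through `x`; small-slope classicality (slopes locally constant)
makes the points over `t_k` classical for `k ≫ 0`; uniformity in `v` from module-finiteness of the
unit ball.  RISKS (why it might fail): accessibility of `Z_loc` at a NON-dominant weight over a
RAMIFIED `L` is unwritten (PatchingLocalComponentBarrier in trianguline clothing); an ORDINARY
automorphic seed on `U(3)` may be needed to certify `Z_loc` and is not supplied by Stub 3 (derive it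
by Hida theory on the definite group, or use BHS accessibility); `p = n = 3` adequacy is a hand check;
Taylor–Wiles primes exist for residual image `S₄` over `K` (kit j007087/j007470: `ad/𝔷`-adequate over
`𝔽₉`) but NOT for image `A₄` over `K` (`Gal(f) = A₄`, or `S₄` with `disc f ∈ −3ℚ^{×2}`): that sub-case
is a further bet inside this stub (candidate engine: crux idea `cubic-resolvent-height-one-patching`,
Skinner–Wiles/Thorne height-one primes on the same definite host) — the lead may reshape it into its
own stub once a slot is free. -/
theorem stub_definiteFern :
    ArcAccumulation →
      ∀ f : ℤ[X], Generic f → HasMuOrdinaryReductionAtThree f →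
      ∀ (ι : PadicAlgCl 3 ≃+* ℂ) (e : Kω →+* ℂ) (S₀ : Set Pl) (ρ : FramedGaloisRep Kω (PadicAlgCl 3) 3),
        S₀.Finite → IsPicardRep ι e f S₀ ρ → ρ.toGaloisRep.IsSemisimple → Polarized ρ →
        (∀ v : Pl, (3 : 𝓞 Kω) ∈ v.asIdeal → LocalShapeAt v ρ) →
        ∀ hcpt : isCompact_glFiniteIntegralLevel 3 Kω, HasPolarizedSeed ι hcpt ρ →
          ∃ S₁ : Set Pl, S₁.Finite ∧ OnDefiniteEigenvariety ι hcpt S₁ ρ := by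
  sorry

/-- **Stub 6 — the card's First lemma + the `ℤ̄_𝔐` dictionary** (M-sized, provable from the accepted
interface): from `OnDefiniteEigenvariety ι hcpt S₁ ρ` and `IsPicardRep ι e f S₀ ρ` (with `S₀ ⊇ {v ∣ 3}`,
both finite) deduce the typed conclusion with `e`, `𝔐 := {z ∈ ℤ̄ : ‖ι⁻¹ z‖ < 1}` (maximal, `∋ 3`),
`S := S₀ ∪ S₁`: a classical `y` within `3^{-k}` of `x` matches a regular algebraic cuspidal `P` whose Hecke
polynomial at `v ∉ S₁` is `ι(X³ − t₁X² + …)`, so `N𝔭·Σα = ι(t₁(y)) ∈ ℤ̄` and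
`‖ι⁻¹(N𝔭·Σα − e(a_𝔭))‖ = ‖t₁(y) − t₁(x)‖ ≤ 3^{-k}`; finally `v_𝔐(t) ≥ k·v(3)` ⇔ `∃ u ∉ 𝔐, u t ∈ 3^k ℤ̄`
(`u` by CRT in the number field `ℚ(t)`: a unit at `𝔐` divisible by the other primes above `3`). -/
theorem stub_limitDictionary :
    ∀ (f : ℤ[X]) (ι : PadicAlgCl 3 ≃+* ℂ) (e : Kω →+* ℂ) (S₀ S₁ : Set Pl)
      (ρ : FramedGaloisRep Kω (PadicAlgCl 3) 3) (hcpt : isCompact_glFiniteIntegralLevel 3 Kω),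
        S₀.Finite → (∀ v : Pl, (3 : 𝓞 Kω) ∈ v.asIdeal → v ∈ S₀) → S₁.Finite →
        IsPicardRep ι e f S₀ ρ → OnDefiniteEigenvariety ι hcpt S₁ ρ → LimitConcl f hcpt := by
  sorry

/-- **Stub 7 — the honest remainder (NOT attacked by this line; hand back with `promote-stub`).**
Generic `f` OUTSIDE the scope: `C_f` not μ-ordinary-λ-distinguished-potentially-good at `3`
(λ-supersingular `y³ − y = x⁴` type, repeated unit root, or not potentially good: refuter objection O1,
"no engine").  This is EXACTLY the route's foreseen child `RTSupersingular` of two-layer plan (1).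
Stated as the crux restricted to `¬ HasMuOrdinaryReductionAtThree f`, with its residual hypothesis
kept, so it is no stronger than the crux itself. -/
theorem stub_supersingularRemainder :
    ∀ (f : ℤ[X]) (hcpt : isCompact_glFiniteIntegralLevel 3 Kω),
        Generic f → ¬ HasMuOrdinaryReductionAtThree f → ResAut f hcpt → LimitConcl f hcpt := by
  sorry


/-! ## The composition: the seven stubs imply the crux, by name -/

/-- **The line concludes the crux.**  `stub_picardRep → stub_muOrdinaryShape → stub_polarizedSeed →
stub_arcAccumulation → stub_definiteFern → stub_limitDictionary → stub_supersingularRemainder →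
MuOrdinaryFamilyRT`, kernel-checked (no `sorry` outside the stubs; this is the only declaration of the
file whose conclusion is the crux decl).  In scope (`HasMuOrdinaryReductionAtThree f`): Stub 1 gives
`ρ`, Stubs 2–3 its local shape at `λ` and its polarised seed, Stub 5 (fed Stub 4) puts it on the
definite eigenvariety with accumulating classical points, Stub 6 reads off the typed limit; out of
scope: Stub 7.  The crux's residual hypothesis `hres` is used only by Stub 7 (triage cross-cutting
note 2). -/
theorem MuOrdinaryFamilyRT_of :
    Summit.Langlands.Langlands.Theses.PicardMuOrdinary.MuOrdinaryFamilyRT := by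
  intro f hcpt hdeg hsep hgal hres
  have hgen : Generic f := ⟨hdeg, hsep, hgal⟩
  by_cases hsc : HasMuOrdinaryReductionAtThree f
  · -- in scope: the definite-fern line
    obtain ⟨ι⟩ := PadicAlgCl.nonempty_ringEquiv_complex 3
    obtain ⟨e, S₀, ρ, hS₀, h3, hss, hpic, hpol⟩ := stub_picardRep f hgen ι
    have hloc : ∀ v : Pl, (3 : 𝓞 Kω) ∈ v.asIdeal → LocalShapeAt v ρ :=
      stub_muOrdinaryShape f hgen hsc ι e S₀ ρ hS₀ hpic hss
    have hseed : HasPolarizedSeed ι hcpt ρ := stub_polarizedSeed f hgen ι e S₀ ρ hS₀ hpic hss hcpt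
    obtain ⟨S₁, hS₁, hE⟩ :=
      stub_definiteFern stub_arcAccumulation f hgen hsc ι e S₀ ρ hS₀ hpic hss hpol hloc hcpt hseed
    exact stub_limitDictionary f ι e S₀ S₁ ρ hcpt hS₀ h3 hS₁ hpic hE
  · -- out of scope: the honest remainder (= the route's foreseen RTSupersingular)
    exact stub_supersingularRemainder f hcpt hgen hsc hres

end Summit.Langlands.Langlands.Cruxes.MuOrdinaryFamilyRT.DefiniteTriangulineFern

end
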